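import Literature.NumberTheory.LFunctions.WeilArchimedeanMoments
import Mathlib.Analysis.SpecialFunctions.SmoothTransition
import Mathlib.Analysis.Complex.Exponential
import Mathlib.Analysis.Complex.ExponentialBounds
import Mathlib.MeasureTheory.Integral.IntervalIntegral.Basic
import Mathlib.Analysis.SumIntegralComparisons
import Mathlib.Analysis.SpecialFunctions.Integrals.Basic

/-!
# Stub `stub_bumpRatio` of line `Sketch` for crux `WeilComb.CombShapePositivity`
(item stmt-RiemannHypothesis-11229, route route-RiemannHypothesis-WeilComb)

Certified numerics for the fixed bump `φ₀(u) = expNegInvGlue (1 - u²)` (`= exp(-1/(1-u²))` on `(-1,1)`,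
`0` outside): with `I₀ = ∫ φ₀` and `N = ‖φ₀‖₂² = ∫ φ₀²` (`weilNorm2Sq`),

`I₀² ≤ (8/5) N`

(true values `I₀ = 0.44399…`, `N = 0.13308…`, ratio `1.4812…`; Cauchy–Schwarz on `[-1,1]` only gives the
ratio `2`). This constant enters the effective window of the comb budget through the diagonal constant
`log(2r)`, `r = I₀²/N`, and every `r`-linear loss.

Proof. `φ₀` is even, vanishes off `[-1,1]` and is non-increasing on `[0,1]` (`expNegInvGlue` is monotone,
`u ↦ 1 - u²` is non-increasing there), so `I₀ = 2∫₀¹ φ₀` is at most twice the left Riemann sum on `50`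
equal pieces and `N = 2∫₀¹ φ₀²` is at least twice the right Riemann sum on the first `34` of `40` equal
pieces (`AntitoneOn.integral_le_sum`, `AntitoneOn.sum_le_integral`, rescaled to `[0,1]`). At a node,
`φ₀ = exp(-x)` with `x = 1/(1-u²)`; it is bounded above by `1/T₈(x)`, `T₈(x) = Σ_{k<8} x^k/k! ≤ exp x`
(`Real.sum_le_exp_of_nonneg`), and `φ₀² = exp(-2x) = (exp(x/4))⁻⁸` is bounded below by `Q₄(x/4)⁻⁸`,
`Q₄(t) = Σ_{k<4} t^k/k! + 5t⁴/96 ≥ exp t` for `t ∈ [0,1]` (`Real.exp_bound'`; `x ≤ 4` for `u ≤ 17/20`).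
The two rational sums are evaluated by `norm_num`: `Σ_{i<50} 1/T₈(x_{i/50}) ≤ 11.2917` and
`Σ_{1≤j≤34} Q₄(x_{j/40}/4)⁻⁸ ≥ 2.5928`, whence `I₀ ≤ 0.451668`, `N ≥ 0.12964` and
`I₀² ≤ 0.204004 ≤ 0.207424 ≤ (8/5)N`.

The file declares no definitions: the two polynomials `T₈` (Horner form) and `Q₄` are written out.
-/

noncomputable section

-- the sub-problem path RiemannHypothesis/RiemannHypothesis duplicates a namespace (D-0017)
set_option linter.dupNamespace false

open MeasureTheory Set

namespace Summit.RiemannHypothesis.RiemannHypothesis.Theorems.WeilCombBohrFejer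

open Literature.NumberTheory.LFunctions

/-! ### The bump: support, continuity, symmetry -/

/-- `φ₀(u) = 0` when `u² ≥ 1`. [folklore] -/
private theorem bump_eq_zero_bumpRatio {u : ℝ} (hu : 1 ≤ u ^ 2) : expNegInvGlue (1 - u ^ 2) = 0 :=
  expNegInvGlue.zero_of_nonpos (by linarith)

/-- `φ₀` is continuous. [folklore] -/
private theorem bump_continuous_bumpRatio : Continuous fun u : ℝ => expNegInvGlue (1 - u ^ 2) :=
  (expNegInvGlue.contDiff (n := 0)).continuous.comp (continuous_const.sub (continuous_id.pow 2))

/-- `∫_ℝ φ₀^k = 2 ∫₀¹ φ₀^k` for `k ≥ 1`: the integrand vanishes off `(-1, 1]` and is even.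
[folklore] -/
private theorem integral_bump_pow_eq_bumpRatio {k : ℕ} (hk : k ≠ 0) :
    ∫ u : ℝ, expNegInvGlue (1 - u ^ 2) ^ k =
      2 * ∫ u in (0 : ℝ)..1, expNegInvGlue (1 - u ^ 2) ^ k := by
  have hc : Continuous fun u : ℝ => expNegInvGlue (1 - u ^ 2) ^ k := bump_continuous_bumpRatio.pow k
  have hs : Function.support (fun u : ℝ => expNegInvGlue (1 - u ^ 2) ^ k) ⊆ Ioc (-1) 1 := by
    intro u hu
    rw [Function.mem_support] at hu
    by_contra h
    apply hu
    rw [bump_eq_zero_bumpRatio, zero_pow hk]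
    simp only [mem_Ioc, not_and_or, not_lt, not_le] at h
    rcases h with h | h <;> nlinarith
  rw [← intervalIntegral.integral_eq_integral_of_support_subset hs,
    ← intervalIntegral.integral_add_adjacent_intervals (b := 0) (hc.intervalIntegrable _ _)
      (hc.intervalIntegrable _ _)]
  have h : ∫ u in (0 : ℝ)..1, expNegInvGlue (1 - (-u) ^ 2) ^ k =
      ∫ u in (-1 : ℝ)..-0, expNegInvGlue (1 - u ^ 2) ^ k :=
    intervalIntegral.integral_comp_neg (a := 0) (b := 1)
      (f := fun u : ℝ => expNegInvGlue (1 - u ^ 2) ^ k)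
  simp only [neg_sq, neg_zero] at h
  rw [← h]
  ring

/-- `‖φ₀‖₂² = ∫_ℝ φ₀²` (the bump is real). [folklore] -/
private theorem weilNorm2Sq_bump_eq_bumpRatio :
    weilNorm2Sq (fun u : ℝ => ((expNegInvGlue (1 - u ^ 2) : ℝ) : ℂ)) =
      ∫ u : ℝ, expNegInvGlue (1 - u ^ 2) ^ 2 := by
  unfold weilNorm2Sq
  congr 1 with u
  rw [Complex.norm_real, Real.norm_eq_abs, sq_abs]

/-! ### Riemann sums on `[0, 1]` for a non-increasing function -/

/-- Left Riemann sum with `n` equal pieces: `∫₀¹ f ≤ n⁻¹ Σ_{i<n} f(i/n)` for `f` non-increasing on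
`[0,1]` (`AntitoneOn.integral_le_sum` rescaled by `y = n u`). [folklore] -/
private theorem integral_le_riemann_bumpRatio {f : ℝ → ℝ} (hf : AntitoneOn f (Icc 0 1)) {n : ℕ}
    (hn : 0 < n) : ∫ u in (0 : ℝ)..1, f u ≤ (n : ℝ)⁻¹ * ∑ i ∈ Finset.range n, f ((i : ℝ) / n) := by
  have hn' : (0 : ℝ) < n := by exact_mod_cast hn
  have hanti : AntitoneOn (fun y : ℝ => f (y / n)) (Icc (0 : ℝ) (0 + n)) := by
    intro a ha b hb hab
    rw [zero_add, mem_Icc] at ha hb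
    exact hf ⟨div_nonneg ha.1 hn'.le, div_le_one_of_le₀ ha.2 hn'.le⟩
      ⟨div_nonneg hb.1 hn'.le, div_le_one_of_le₀ hb.2 hn'.le⟩ (div_le_div_of_nonneg_right hab hn'.le)
  have h : ∫ x in (0 : ℝ)..0 + n, f (x / n) ≤ ∑ i ∈ Finset.range n, f ((0 + i) / n) :=
    hanti.integral_le_sum
  rw [intervalIntegral.integral_comp_div _ hn'.ne', zero_add, zero_div, div_self hn'.ne',
    smul_eq_mul] at h
  simp only [zero_add] at h
  rw [le_inv_mul_iff₀ hn']
  exact h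

/-- Right Riemann sum on the first `m` of `n` equal pieces: `n⁻¹ Σ_{i<m} f((i+1)/n) ≤ ∫₀¹ f` for
`f ≥ 0` non-increasing on `[0,1]` (`AntitoneOn.sum_le_integral` rescaled, and `∫₀^{m/n} f ≤ ∫₀¹ f`).
[folklore] -/
private theorem riemann_le_integral_bumpRatio {f : ℝ → ℝ} (hf : AntitoneOn f (Icc 0 1))
    (h0 : ∀ u ∈ Icc (0 : ℝ) 1, 0 ≤ f u) {n m : ℕ} (hn : 0 < n) (hm : m ≤ n) :
    (n : ℝ)⁻¹ * ∑ i ∈ Finset.range m, f (((i + 1 : ℕ) : ℝ) / n) ≤ ∫ u in (0 : ℝ)..1, f u := by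
  have hn' : (0 : ℝ) < n := by exact_mod_cast hn
  have hmn : (m : ℝ) / n ≤ 1 := div_le_one_of_le₀ (by exact_mod_cast hm) hn'.le
  have hanti : AntitoneOn (fun y : ℝ => f (y / n)) (Icc (0 : ℝ) (0 + m)) := by
    intro a ha b hb hab
    rw [zero_add, mem_Icc] at ha hb
    refine hf ⟨div_nonneg ha.1 hn'.le, ?_⟩ ⟨div_nonneg hb.1 hn'.le, ?_⟩
      (div_le_div_of_nonneg_right hab hn'.le)
    · exact (div_le_div_of_nonneg_right ha.2 hn'.le).trans hmn
    · exact (div_le_div_of_nonneg_right hb.2 hn'.le).trans hmn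
  have h : ∑ i ∈ Finset.range m, f ((0 + ((i + 1 : ℕ) : ℝ)) / n) ≤
      ∫ x in (0 : ℝ)..0 + m, f (x / n) :=
    hanti.sum_le_integral
  rw [intervalIntegral.integral_comp_div _ hn'.ne', zero_add, zero_div, smul_eq_mul] at h
  simp only [zero_add] at h
  have hmono : ∫ x in (0 : ℝ)..m / n, f x ≤ ∫ u in (0 : ℝ)..1, f u := by
    apply intervalIntegral.integral_mono_interval le_rfl (by positivity) hmn
    · exact ae_restrict_of_forall_mem measurableSet_Ioc fun u hu => h0 u (Ioc_subset_Icc_self hu)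
    · exact (hf.mono (by rw [uIcc_of_le (by norm_num : (0 : ℝ) ≤ 1)])).intervalIntegrable
  rw [inv_mul_le_iff₀ hn']
  exact h.trans (mul_le_mul_of_nonneg_left hmono hn'.le)

/-! ### Node values: rational bounds for `exp` -/

/-- `φ₀(u) = exp(-1/(1-u²))` for `u² < 1`. [folklore] -/
private theorem bump_eq_exp_bumpRatio {u : ℝ} (hu : u ^ 2 < 1) :
    expNegInvGlue (1 - u ^ 2) = Real.exp (-(1 - u ^ 2)⁻¹) := by
  rw [expNegInvGlue, if_neg (not_le.2 (by linarith))]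

/-- Upper node bound: `exp(-x) ≤ 1/T₈(x)` for `x ≥ 0`, where `T₈(x) = Σ_{k<8} x^k/k! ≤ exp x` is the
degree-7 Taylor polynomial of `exp`, written in Horner form (`Real.sum_le_exp_of_nonneg`). [folklore] -/
private theorem exp_neg_le_inv_taylor_bumpRatio {x : ℝ} (hx : 0 ≤ x) :
    Real.exp (-x) ≤
      (1 + x * (1 + x / 2 * (1 + x / 3 * (1 + x / 4 * (1 + x / 5 * (1 + x / 6 * (1 + x / 7)))))))⁻¹ := by
  have he : 1 + x * (1 + x / 2 * (1 + x / 3 * (1 + x / 4 * (1 + x / 5 * (1 + x / 6 * (1 + x / 7))))))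
      = ∑ k ∈ Finset.range 8, x ^ k / (k.factorial : ℝ) := by
    simp only [Finset.sum_range_succ, Finset.sum_range_zero, Nat.factorial]
    push_cast
    ring
  rw [Real.exp_neg]
  refine inv_anti₀ (by positivity) ?_
  rw [he]
  exact Real.sum_le_exp_of_nonneg hx 8

/-- Lower node bound: `Q₄(x/4)⁻⁸ ≤ (exp(x/4))⁻⁸ = exp(-x)²` for `0 ≤ x ≤ 4`, where
`Q₄(t) = Σ_{k<4} t^k/k! + 5t⁴/96 ≥ exp t` on `[0,1]` (`Real.exp_bound'` with `n = 4`). [folklore] -/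
private theorem inv_taylor_pow_le_exp_neg_sq_bumpRatio {x : ℝ} (h0 : 0 ≤ x) (h4 : x ≤ 4) :
    ((1 + x / 4 * (1 + x / 4 / 2 * (1 + x / 4 / 3)) + (x / 4) ^ 4 * 5 / 96) ^ 8)⁻¹ ≤
      Real.exp (-x) ^ 2 := by
  have hq : Real.exp (x / 4) ≤
      1 + x / 4 * (1 + x / 4 / 2 * (1 + x / 4 / 3)) + (x / 4) ^ 4 * 5 / 96 := by
    refine (Real.exp_bound' (by positivity) (by linarith) (n := 4) (by norm_num)).trans
      (le_of_eq ?_)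
    simp only [Finset.sum_range_succ, Finset.sum_range_zero, Nat.factorial]
    push_cast
    ring
  have h1 : Real.exp (-x) ^ 2 = (Real.exp (x / 4) ^ 8)⁻¹ := by
    rw [← Real.exp_nat_mul, ← Real.exp_nat_mul, ← Real.exp_neg]
    congr 1
    push_cast
    ring
  rw [h1]
  exact inv_anti₀ (pow_pos (Real.exp_pos _) 8) (pow_le_pow_left₀ (Real.exp_pos _).le hq 8)

/-- The upper Riemann sum, node by node: `Σ_{i<50} 1/T₈(x_i) ≤ 11.2917`, `x_i = 1/(1-(i/50)²)`
(exact rational arithmetic, `norm_num`). [folklore] -/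
private theorem sum_nodeU_le_bumpRatio :
    ∑ i ∈ Finset.range 50,
      (1 + (1 - ((i : ℝ) / 50) ^ 2)⁻¹ * (1 + (1 - ((i : ℝ) / 50) ^ 2)⁻¹ / 2 *
        (1 + (1 - ((i : ℝ) / 50) ^ 2)⁻¹ / 3 * (1 + (1 - ((i : ℝ) / 50) ^ 2)⁻¹ / 4 *
          (1 + (1 - ((i : ℝ) / 50) ^ 2)⁻¹ / 5 * (1 + (1 - ((i : ℝ) / 50) ^ 2)⁻¹ / 6 *
            (1 + (1 - ((i : ℝ) / 50) ^ 2)⁻¹ / 7)))))))⁻¹ ≤ 112917 / 10000 := by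
  simp only [Finset.sum_range_succ, Finset.sum_range_zero]
  push_cast
  norm_num

/-- The lower Riemann sum, node by node: `2.5928 ≤ Σ_{j<34} Q₄(x_j/4)⁻⁸`, `x_j = 1/(1-((j+1)/40)²)`
(exact rational arithmetic, `norm_num`). [folklore] -/
private theorem le_sum_nodeL_bumpRatio :
    (25928 : ℝ) / 10000 ≤
      ∑ i ∈ Finset.range 34,
        ((1 + (1 - (((i + 1 : ℕ) : ℝ) / 40) ^ 2)⁻¹ / 4 *
            (1 + (1 - (((i + 1 : ℕ) : ℝ) / 40) ^ 2)⁻¹ / 4 / 2 *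
              (1 + (1 - (((i + 1 : ℕ) : ℝ) / 40) ^ 2)⁻¹ / 4 / 3)) +
          ((1 - (((i + 1 : ℕ) : ℝ) / 40) ^ 2)⁻¹ / 4) ^ 4 * 5 / 96) ^ 8)⁻¹ := by
  simp only [Finset.sum_range_succ, Finset.sum_range_zero]
  push_cast
  norm_num

/-! ### The stub -/

/-- **Stub `stub_bumpRatio`** (registered signature, line `Sketch`): for the fixed bump
`φ₀(u) = expNegInvGlue (1 - u²)`, `I₀² ≤ (8/5) N` with `I₀ = ∫ φ₀`, `N = ‖φ₀‖₂²`; certified by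
Riemann sums of the non-increasing `φ₀`, `φ₀²` on `[0,1]` (`I₀ ≤ 0.451668`, `N ≥ 0.12964`) with
Taylor bounds for `exp` at the `50 + 34` rational nodes. [folklore] -/
theorem stub_bumpRatio :
    (∫ u : ℝ, expNegInvGlue (1 - u ^ 2)) ^ 2 ≤
      8 / 5 * Literature.NumberTheory.LFunctions.weilNorm2Sq
        (fun u : ℝ => ((expNegInvGlue (1 - u ^ 2) : ℝ) : ℂ)) := by
  have hanti : AntitoneOn (fun u : ℝ => expNegInvGlue (1 - u ^ 2)) (Icc 0 1) := by
    intro a ha b hb hab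
    show expNegInvGlue (1 - b ^ 2) ≤ expNegInvGlue (1 - a ^ 2)
    exact expNegInvGlue.monotone (by nlinarith [ha.1, pow_le_pow_left₀ ha.1 hab 2])
  have hanti2 : AntitoneOn (fun u : ℝ => expNegInvGlue (1 - u ^ 2) ^ 2) (Icc 0 1) := by
    intro a ha b hb hab
    show expNegInvGlue (1 - b ^ 2) ^ 2 ≤ expNegInvGlue (1 - a ^ 2) ^ 2
    exact pow_le_pow_left₀ (expNegInvGlue.nonneg _) (hanti ha hb hab) 2
  have hI : ∫ u : ℝ, expNegInvGlue (1 - u ^ 2) = 2 * ∫ u in (0 : ℝ)..1, expNegInvGlue (1 - u ^ 2) := by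
    have h := integral_bump_pow_eq_bumpRatio one_ne_zero
    simp only [pow_one] at h
    exact h
  have hN : weilNorm2Sq (fun u : ℝ => ((expNegInvGlue (1 - u ^ 2) : ℝ) : ℂ)) =
      2 * ∫ u in (0 : ℝ)..1, expNegInvGlue (1 - u ^ 2) ^ 2 := by
    rw [weilNorm2Sq_bump_eq_bumpRatio, integral_bump_pow_eq_bumpRatio two_ne_zero]
  -- upper Riemann bound for `I₀/2`
  have hU : ∫ u in (0 : ℝ)..1, expNegInvGlue (1 - u ^ 2) ≤ (50 : ℝ)⁻¹ * (112917 / 10000) := by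
    refine (integral_le_riemann_bumpRatio hanti (n := 50) (by norm_num)).trans ?_
    simp only [Nat.cast_ofNat]
    refine mul_le_mul_of_nonneg_left
      ((Finset.sum_le_sum fun i hi => ?_).trans sum_nodeU_le_bumpRatio) (by norm_num)
    have hi' : (i : ℝ) < 50 := by exact_mod_cast Finset.mem_range.1 hi
    have h0 : (0 : ℝ) ≤ i := Nat.cast_nonneg i
    have hu : ((i : ℝ) / 50) ^ 2 < 1 := by rw [div_pow, div_lt_one (by norm_num)]; nlinarith
    rw [bump_eq_exp_bumpRatio hu]
    exact exp_neg_le_inv_taylor_bumpRatio (inv_pos.2 (by linarith)).le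
  -- lower Riemann bound for `N/2`
  have hL : (40 : ℝ)⁻¹ * (25928 / 10000) ≤ ∫ u in (0 : ℝ)..1, expNegInvGlue (1 - u ^ 2) ^ 2 := by
    refine le_trans ?_ (riemann_le_integral_bumpRatio hanti2 (fun u _ => sq_nonneg _) (n := 40)
      (m := 34) (by norm_num) (by norm_num))
    simp only [Nat.cast_ofNat]
    refine mul_le_mul_of_nonneg_left
      (le_sum_nodeL_bumpRatio.trans (Finset.sum_le_sum fun i hi => ?_)) (by norm_num)
    have hi' : ((i + 1 : ℕ) : ℝ) ≤ 34 := by exact_mod_cast Finset.mem_range.1 hi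
    have h0 : (0 : ℝ) ≤ ((i + 1 : ℕ) : ℝ) := Nat.cast_nonneg _
    have hsq : (((i + 1 : ℕ) : ℝ) / 40) ^ 2 ≤ 289 / 400 := by
      rw [div_pow, div_le_div_iff₀ (by norm_num) (by norm_num)]
      nlinarith
    rw [bump_eq_exp_bumpRatio (by linarith)]
    exact inv_taylor_pow_le_exp_neg_sq_bumpRatio (inv_pos.2 (by linarith)).le
      (by rw [inv_le_comm₀ (by linarith) (by norm_num)]; linarith)
  -- assemble: `I₀ = 2·(I₀/2) ≤ 0.451668`, `N = 2·(N/2) ≥ 0.12964`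
  have hI0 : 0 ≤ ∫ u in (0 : ℝ)..1, expNegInvGlue (1 - u ^ 2) :=
    intervalIntegral.integral_nonneg zero_le_one fun u _ => expNegInvGlue.nonneg _
  have hsq := pow_le_pow_left₀ hI0 hU 2
  rw [hI, hN]
  nlinarith [hsq, hL]

end Summit.RiemannHypothesis.RiemannHypothesis.Theorems.WeilCombBohrFejer

end
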